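import Summits.CriticalPhenomena.CardyFormulaZ2.Theorems.CardyComplexConeEdgePrecompactUFRSRectLatticeBox

/-!
# The discrete boundary of an axis-parallel rectangle is monochromatic away from the marked edges
(line `qkz-strip-boundary-arm` of crux `CardyComplexCone.EdgePrecompact`, stmt-CriticalPhenomena-11387;
Part B of the geometric input of the registered one-strand decay `ufrs_rect_oneStrandDecay` (ONE):
the registered sub-goal `ufrs_rect_boundaryMonochromatic`, feeding the dictionary
`ufrs_strand_genuineCrossing` of `…EdgePrecompactUFRSOneStrandGenuine.lean`; Part A
`…EdgePrecompactUFRSRectLatticeBox.lean` is the lattice box of the rectangle)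

**Theorem** (`ufrs_rect_boundaryMonochromatic`). Let `E` be `ℤ²`-admissible Dobrushin data of the
open rectangle `(x₀, x₁) × (y₀, y₁)`, `z ∈ ℂ` and `T` a radius with `E.δ ≤ T` and `8T` at most the
short side. If every marked (`A`–`B`) edge of `E` has its midpoint at distance `≥ 2T` from `z`, then
the discrete boundary sites within distance `T` of `z` all lie in `E.zdArcA` or all in `E.zdArcB`.
Proof: by Part A the discrete boundary is the set of box sites on the four sides of the lattice box
and `Ω_δ` is the nearest-neighbour graph on the box; two lattice-adjacent boundary sites in the
sup-norm box of half-side `T` around `z` have the same colour, for otherwise they span a marked edge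
with midpoint within `√2 T < 2T` of `z` (`same_arc_of_adj`); colours propagate along rows and
columns of boundary sites inside the box (`row_same_arc`, `col_same_arc`) and from a row to a column
through the corner of the box (`corner_same_arc`), while boundary sites of opposite sides cannot
both lie in the box (`8T ≤` side; `hsides_same_arc`, `vsides_same_arc`): `same_arc`.

References: S. Smirnov, C. R. Acad. Sci. Paris 333 (2001), §2 (discrete domain, arcs, marked
edges); D. Chelkak, S. Smirnov, Invent. Math. 189 (2012), §1.2 (discretisation conventions).
-/

set_option linter.unusedVariables false

namespace Summit.CriticalPhenomena.CardyFormulaZ2.Cruxes.EdgePrecompact.QkzStripBoundaryArm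

open MeasureTheory Filter Set Metric
open scoped Topology BigOperators Pointwise
open Literature.Probability.LatticeModels Literature.Probability.Percolation
open Literature.Probability.RandomPlanarGeometry (DobrushinDomain)
open Summit.CriticalPhenomena.CardyFormulaZ2.Theses.CardyComplexCone

noncomputable section

/-! ## Colours of adjacent boundary sites inside the box around `z` -/

section Colour

variable {x₀ x₁ y₀ y₁ : ℝ} {E : DiscreteDobrushin} {z : ℂ} {T : ℝ}

/-- A point whose two coordinates are within `T` of those of `z` is at distance `< 2T` from `z`
(`√2 T < 2T`). -/
theorem dist_lt_two_mul_of_abs_le {m z : ℂ} {T : ℝ} (hT : 0 < T) (hre : |m.re - z.re| ≤ T)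
    (him : |m.im - z.im| ≤ T) : dist m z < 2 * T := by
  rw [Complex.dist_eq]
  have h1 : (m - z).re ^ 2 ≤ T ^ 2 := by
    rw [Complex.sub_re]; exact (sq_abs _).symm.le.trans (pow_le_pow_left₀ (abs_nonneg _) hre 2)
  have h2 : (m - z).im ^ 2 ≤ T ^ 2 := by
    rw [Complex.sub_im]; exact (sq_abs _).symm.le.trans (pow_le_pow_left₀ (abs_nonneg _) him 2)
  have h3 : ‖m - z‖ ^ 2 < (2 * T) ^ 2 := by
    rw [Complex.sq_norm, Complex.normSq_apply]; nlinarith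
  exact lt_of_pow_lt_pow_left₀ 2 (by positivity) h3

/-- **Adjacent boundary sites in the box have the same colour.** If no marked edge of `E` has its
midpoint within `2T` of `z`, two lattice-adjacent discrete boundary sites whose coordinates are
within `T` of those of `z` are both on the wired arc or both off it: otherwise they would span a
marked (`A`–`B`) edge with midpoint within `√2 T` of `z`. -/
theorem same_arc_of_adj (hE : E.IsZdAdmissible) (hEΩ : E.Ω = Set.Ioo x₀ x₁ ×ℂ Set.Ioo y₀ y₁) (hT : 0 < T)
    (hnoAB : ∀ e₀ ∈ E.zdABEdges, 2 * T ≤ dist (medialPoint E.δ e₀) z)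
    {x y : Site 2} (hx : x ∈ E.zdBoundary) (hy : y ∈ E.zdBoundary) (hxy : (zdGraph 2).Adj x y)
    (hbx : |E.δ * x 0 - z.re| ≤ T ∧ |E.δ * x 1 - z.im| ≤ T)
    (hby : |E.δ * y 0 - z.re| ≤ T ∧ |E.δ * y 1 - z.im| ≤ T) :
    (x ∈ E.zdArcA ↔ y ∈ E.zdArcA) := by
  have hxV := meshDomain_subset_meshVertices _ _ (E.zdBoundary_subset_meshDomain hx)
  have hyV := meshDomain_subset_meshVertices _ _ (E.zdBoundary_subset_meshDomain hy)
  have hdom : (discreteDomainGraph E.Ω E.δ).Adj x y := (dom_adj_iff_rect hE hEΩ).2 ⟨hxy, hxV, hyV⟩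
  have hedge : s(x, y) ∈ (discreteDomainGraph E.Ω E.δ).edgeSet := (SimpleGraph.mem_edgeSet _).2 hdom
  -- the edge `{x, y}` is not marked: its midpoint is too close to `z`
  have hnot : s(x, y) ∉ E.zdABEdges := by
    intro h
    have h2 := hnoAB _ h
    have hlt : dist (medialPoint E.δ s(x, y)) z < 2 * T := by
      refine dist_lt_two_mul_of_abs_le hT ?_ ?_
      · have ha := abs_le.1 hbx.1
        have hb := abs_le.1 hby.1
        rw [medialPoint_mk, Complex.div_ofNat_re, Complex.add_re, meshPoint_re, meshPoint_re]
        exact abs_le.2 ⟨by linarith, by linarith⟩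
      · have ha := abs_le.1 hbx.2
        have hb := abs_le.1 hby.2
        rw [medialPoint_mk, Complex.div_ofNat_im, Complex.add_im, meshPoint_im, meshPoint_im]
        exact abs_le.2 ⟨by linarith, by linarith⟩
    linarith
  have hxAB := hE.zdBoundary_subset hx
  have hyAB := hE.zdBoundary_subset hy
  constructor
  · intro hxA
    by_contra hyA
    have hyB : y ∈ E.zdArcB := hyAB.resolve_left hyA
    exact hnot ⟨hedge, ⟨x, Sym2.mem_mk_left _ _, hxA⟩, ⟨y, Sym2.mem_mk_right _ _, hyB⟩⟩
  · intro hyA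
    by_contra hxA
    have hxB : x ∈ E.zdArcB := hxAB.resolve_left hxA
    exact hnot ⟨hedge, ⟨y, Sym2.mem_mk_right _ _, hyA⟩, ⟨x, Sym2.mem_mk_left _ _, hxB⟩⟩

end Colour

/-! ## Colour propagation along the sides of the box -/

section Chains

variable {x₀ x₁ y₀ y₁ : ℝ} {E : DiscreteDobrushin} {z : ℂ} {T : ℝ}

/-- **Along a row.** Boundary sites `![k, n]`, `k₁ ≤ k ≤ k₂`, of one row of the box whose
abscissae stay within `T` of `z.re` (ordinate within `T` of `z.im`) all have the colour of the
first one. -/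
theorem row_same_arc (hE : E.IsZdAdmissible) (hEΩ : E.Ω = Set.Ioo x₀ x₁ ×ℂ Set.Ioo y₀ y₁) (hT : 0 < T)
    (hnoAB : ∀ e₀ ∈ E.zdABEdges, 2 * T ≤ dist (medialPoint E.δ e₀) z) {n : ℤ}
    (hn : |E.δ * n - z.im| ≤ T)
    (hrow : ∀ k : ℤ, (![k, n] : Site 2) ∈ meshVertices E.Ω E.δ → (![k, n] : Site 2) ∈ E.zdBoundary)
    {k₁ k₂ : ℤ} (hk : k₁ ≤ k₂) (h₁ : (![k₁, n] : Site 2) ∈ meshVertices E.Ω E.δ)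
    (h₂ : (![k₂, n] : Site 2) ∈ meshVertices E.Ω E.δ) (hb₁ : |E.δ * k₁ - z.re| ≤ T)
    (hb₂ : |E.δ * k₂ - z.re| ≤ T) :
    ((![k₁, n] : Site 2) ∈ E.zdArcA ↔ (![k₂, n] : Site 2) ∈ E.zdArcA) := by
  have hV : ∀ k : ℤ, (![k, n] : Site 2) ∈ meshVertices E.Ω E.δ ↔
      (x₀ < E.δ * k ∧ E.δ * k < x₁) ∧ (y₀ < E.δ * n ∧ E.δ * n < y₁) := fun k => by
    rw [mem_meshVertices_rect' hEΩ]; simp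
  have hδ := hE.delta_pos
  have h₁' := (hV _).1 h₁
  have h₂' := (hV _).1 h₂
  have hab₁ := abs_le.1 hb₁
  have hab₂ := abs_le.1 hb₂
  have hmid : ∀ k : ℤ, k₁ ≤ k → k ≤ k₂ →
      (![k, n] : Site 2) ∈ meshVertices E.Ω E.δ ∧ |E.δ * k - z.re| ≤ T := by
    intro k hk1 hk2
    have hk1' : (k₁ : ℝ) ≤ k := by exact_mod_cast hk1
    have hk2' : (k : ℝ) ≤ k₂ := by exact_mod_cast hk2
    have e1 : E.δ * k₁ ≤ E.δ * k := mul_le_mul_of_nonneg_left hk1' hδ.le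
    have e2 : E.δ * k ≤ E.δ * k₂ := mul_le_mul_of_nonneg_left hk2' hδ.le
    exact ⟨(hV k).2 ⟨⟨by linarith [h₁'.1.1], by linarith [h₂'.1.2]⟩, h₁'.2⟩,
      abs_le.2 ⟨by linarith, by linarith⟩⟩
  obtain ⟨m, rfl⟩ : ∃ m : ℕ, k₂ = k₁ + m := ⟨(k₂ - k₁).toNat, by omega⟩
  clear hk h₂ hb₂ h₂' hab₂
  induction m with
  | zero => simp
  | succ m ih =>
    have hm1 : k₁ ≤ k₁ + (m : ℤ) := by omega
    have hm2 : k₁ + (m : ℤ) ≤ k₁ + ((m + 1 : ℕ) : ℤ) := by push_cast; omega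
    obtain ⟨hmV, hmT⟩ := hmid _ hm1 hm2
    obtain ⟨hsV, hsT⟩ := hmid _ (hm1.trans hm2) le_rfl
    have ih' := ih (fun k hk1 hk2 => hmid k hk1 (hk2.trans hm2))
    have hadj : (zdGraph 2).Adj (![k₁ + (m : ℤ), n] : Site 2) ![k₁ + ((m + 1 : ℕ) : ℤ), n] := by
      have := adj_right_or_up (k₁ + m) n _ _ (Or.inl ⟨rfl, rfl⟩)
      push_cast
      rwa [← add_assoc]
    have hstep := same_arc_of_adj hE hEΩ hT hnoAB (hrow _ hmV) (hrow _ hsV) hadj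
      ⟨by simpa using hmT, by simpa using hn⟩ ⟨by simpa using hsT, by simpa using hn⟩
    exact ih'.trans hstep

/-- **Along a column.** Boundary sites `![n, k]`, `k₁ ≤ k ≤ k₂`, of one column of the box whose
ordinates stay within `T` of `z.im` (abscissa within `T` of `z.re`) all have the colour of the
first one. -/
theorem col_same_arc (hE : E.IsZdAdmissible) (hEΩ : E.Ω = Set.Ioo x₀ x₁ ×ℂ Set.Ioo y₀ y₁) (hT : 0 < T)
    (hnoAB : ∀ e₀ ∈ E.zdABEdges, 2 * T ≤ dist (medialPoint E.δ e₀) z) {n : ℤ}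
    (hn : |E.δ * n - z.re| ≤ T)
    (hcol : ∀ k : ℤ, (![n, k] : Site 2) ∈ meshVertices E.Ω E.δ → (![n, k] : Site 2) ∈ E.zdBoundary)
    {k₁ k₂ : ℤ} (hk : k₁ ≤ k₂) (h₁ : (![n, k₁] : Site 2) ∈ meshVertices E.Ω E.δ)
    (h₂ : (![n, k₂] : Site 2) ∈ meshVertices E.Ω E.δ) (hb₁ : |E.δ * k₁ - z.im| ≤ T)
    (hb₂ : |E.δ * k₂ - z.im| ≤ T) :
    ((![n, k₁] : Site 2) ∈ E.zdArcA ↔ (![n, k₂] : Site 2) ∈ E.zdArcA) := by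
  have hV : ∀ k : ℤ, (![n, k] : Site 2) ∈ meshVertices E.Ω E.δ ↔
      (x₀ < E.δ * n ∧ E.δ * n < x₁) ∧ (y₀ < E.δ * k ∧ E.δ * k < y₁) := fun k => by
    rw [mem_meshVertices_rect' hEΩ]; simp
  have hδ := hE.delta_pos
  have h₁' := (hV _).1 h₁
  have h₂' := (hV _).1 h₂
  have hab₁ := abs_le.1 hb₁
  have hab₂ := abs_le.1 hb₂
  have hmid : ∀ k : ℤ, k₁ ≤ k → k ≤ k₂ →
      (![n, k] : Site 2) ∈ meshVertices E.Ω E.δ ∧ |E.δ * k - z.im| ≤ T := by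
    intro k hk1 hk2
    have hk1' : (k₁ : ℝ) ≤ k := by exact_mod_cast hk1
    have hk2' : (k : ℝ) ≤ k₂ := by exact_mod_cast hk2
    have e1 : E.δ * k₁ ≤ E.δ * k := mul_le_mul_of_nonneg_left hk1' hδ.le
    have e2 : E.δ * k ≤ E.δ * k₂ := mul_le_mul_of_nonneg_left hk2' hδ.le
    exact ⟨(hV k).2 ⟨h₁'.1, by linarith [h₁'.2.1], by linarith [h₂'.2.2]⟩,
      abs_le.2 ⟨by linarith, by linarith⟩⟩
  obtain ⟨m, rfl⟩ : ∃ m : ℕ, k₂ = k₁ + m := ⟨(k₂ - k₁).toNat, by omega⟩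
  clear hk h₂ hb₂ h₂' hab₂
  induction m with
  | zero => simp
  | succ m ih =>
    have hm1 : k₁ ≤ k₁ + (m : ℤ) := by omega
    have hm2 : k₁ + (m : ℤ) ≤ k₁ + ((m + 1 : ℕ) : ℤ) := by push_cast; omega
    obtain ⟨hmV, hmT⟩ := hmid _ hm1 hm2
    obtain ⟨hsV, hsT⟩ := hmid _ (hm1.trans hm2) le_rfl
    have ih' := ih (fun k hk1 hk2 => hmid k hk1 (hk2.trans hm2))
    have hadj : (zdGraph 2).Adj (![n, k₁ + (m : ℤ)] : Site 2) ![n, k₁ + ((m + 1 : ℕ) : ℤ)] := by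
      have := adj_right_or_up n (k₁ + m) _ _ (Or.inr ⟨rfl, rfl⟩)
      push_cast
      rwa [← add_assoc]
    have hstep := same_arc_of_adj hE hEΩ hT hnoAB (hcol _ hmV) (hcol _ hsV) hadj
      ⟨by simpa using hn, by simpa using hmT⟩ ⟨by simpa using hn, by simpa using hsT⟩
    exact ih'.trans hstep

/-- **Through a corner of the box.** A boundary site `p` on a horizontal side and a boundary site
`q` on a vertical side, both in the box around `z`, have the same colour: go along the row of `p`
to the corner `![q 0, p 1]` of the box, then along the column of `q`. -/
theorem corner_same_arc (hE : E.IsZdAdmissible) (hEΩ : E.Ω = Set.Ioo x₀ x₁ ×ℂ Set.Ioo y₀ y₁) (hT : 0 < T)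
    (hnoAB : ∀ e₀ ∈ E.zdABEdges, 2 * T ≤ dist (medialPoint E.δ e₀) z) {p q : Site 2}
    (hp : p ∈ E.zdBoundary) (hq : q ∈ E.zdBoundary)
    (hph : E.δ * (p 1 - 1) ≤ y₀ ∨ y₁ ≤ E.δ * (p 1 + 1)) (hqv : E.δ * (q 0 - 1) ≤ x₀ ∨ x₁ ≤ E.δ * (q 0 + 1))
    (hbp : |E.δ * p 0 - z.re| ≤ T ∧ |E.δ * p 1 - z.im| ≤ T)
    (hbq : |E.δ * q 0 - z.re| ≤ T ∧ |E.δ * q 1 - z.im| ≤ T) :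
    (p ∈ E.zdArcA ↔ q ∈ E.zdArcA) := by
  have hpV := meshDomain_subset_meshVertices _ _ (E.zdBoundary_subset_meshDomain hp)
  have hqV := meshDomain_subset_meshVertices _ _ (E.zdBoundary_subset_meshDomain hq)
  have hpV' := (mem_meshVertices_rect' hEΩ).1 hpV
  have hqV' := (mem_meshVertices_rect' hEΩ).1 hqV
  have e_p : (![p 0, p 1] : Site 2) = p := by ext k; fin_cases k <;> rfl
  have e_q : (![q 0, q 1] : Site 2) = q := by ext k; fin_cases k <;> rfl
  have hcV : (![q 0, p 1] : Site 2) ∈ meshVertices E.Ω E.δ :=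
    (mem_meshVertices_rect' hEΩ).2 ⟨by simpa using hqV'.1, by simpa using hpV'.2⟩
  have hrowB : ∀ k : ℤ, (![k, p 1] : Site 2) ∈ meshVertices E.Ω E.δ → (![k, p 1] : Site 2) ∈ E.zdBoundary :=
    fun k hk => mem_zdBoundary_of_side hE hEΩ hk (Or.inl (by simpa using hph))
  have hcolB : ∀ k : ℤ, (![q 0, k] : Site 2) ∈ meshVertices E.Ω E.δ → (![q 0, k] : Site 2) ∈ E.zdBoundary :=
    fun k hk => mem_zdBoundary_of_side hE hEΩ hk (Or.inr (by simpa using hqv))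
  have hpV₀ : (![p 0, p 1] : Site 2) ∈ meshVertices E.Ω E.δ := by rw [e_p]; exact hpV
  have hqV₀ : (![q 0, q 1] : Site 2) ∈ meshVertices E.Ω E.δ := by rw [e_q]; exact hqV
  have h1 : (p ∈ E.zdArcA ↔ (![q 0, p 1] : Site 2) ∈ E.zdArcA) := by
    rcases le_total (p 0) (q 0) with h | h
    · have := row_same_arc hE hEΩ hT hnoAB hbp.2 hrowB h hpV₀ hcV hbp.1 hbq.1
      rwa [e_p] at this
    · have := row_same_arc hE hEΩ hT hnoAB hbp.2 hrowB h hcV hpV₀ hbq.1 hbp.1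
      rw [e_p] at this
      exact this.symm
  have h2 : ((![q 0, p 1] : Site 2) ∈ E.zdArcA ↔ q ∈ E.zdArcA) := by
    rcases le_total (p 1) (q 1) with h | h
    · have := col_same_arc hE hEΩ hT hnoAB hbq.1 hcolB h hcV hqV₀ hbp.2 hbq.2
      rwa [e_q] at this
    · have := col_same_arc hE hEΩ hT hnoAB hbq.1 hcolB h hqV₀ hcV hbq.2 hbp.2
      rw [e_q] at this
      exact this.symm
  exact h1.trans h2

/-- **Two boundary sites on horizontal sides.** In the box (with `2T + 2δ <` the height) they lie
on the same row, where the colour propagates. -/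
theorem hsides_same_arc (hE : E.IsZdAdmissible) (hEΩ : E.Ω = Set.Ioo x₀ x₁ ×ℂ Set.Ioo y₀ y₁) (hT : 0 < T)
    (hnoAB : ∀ e₀ ∈ E.zdABEdges, 2 * T ≤ dist (medialPoint E.δ e₀) z) (hTy : 2 * T + 2 * E.δ < y₁ - y₀)
    {p q : Site 2} (hp : p ∈ E.zdBoundary) (hq : q ∈ E.zdBoundary)
    (hph : E.δ * (p 1 - 1) ≤ y₀ ∨ y₁ ≤ E.δ * (p 1 + 1)) (hqh : E.δ * (q 1 - 1) ≤ y₀ ∨ y₁ ≤ E.δ * (q 1 + 1))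
    (hbp : |E.δ * p 0 - z.re| ≤ T ∧ |E.δ * p 1 - z.im| ≤ T)
    (hbq : |E.δ * q 0 - z.re| ≤ T ∧ |E.δ * q 1 - z.im| ≤ T) :
    (p ∈ E.zdArcA ↔ q ∈ E.zdArcA) := by
  have hδ := hE.delta_pos
  -- two boundary sites on horizontal sides, in the box, lie on the same row
  have key : ∀ {p q : Site 2}, p ∈ E.zdBoundary → q ∈ E.zdBoundary →
      (E.δ * (p 1 - 1) ≤ y₀ ∨ y₁ ≤ E.δ * (p 1 + 1)) → (E.δ * (q 1 - 1) ≤ y₀ ∨ y₁ ≤ E.δ * (q 1 + 1)) →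
      |E.δ * p 1 - z.im| ≤ T → |E.δ * q 1 - z.im| ≤ T → p 1 < q 1 → False := by
    intro p q hp hq hph hqh hbp hbq hlt
    have hpV' := (mem_meshVertices_rect' hEΩ).1
      (meshDomain_subset_meshVertices _ _ (E.zdBoundary_subset_meshDomain hp))
    have hqV' := (mem_meshVertices_rect' hEΩ).1
      (meshDomain_subset_meshVertices _ _ (E.zdBoundary_subset_meshDomain hq))
    have hle : (p 1 : ℝ) + 1 ≤ q 1 := by exact_mod_cast hlt
    have hle' : E.δ * ((p 1 : ℝ) + 1) ≤ E.δ * q 1 := mul_le_mul_of_nonneg_left hle hδ.le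
    have hp1 := abs_le.1 hbp
    have hq1 := abs_le.1 hbq
    rcases hph with hpb | hpt
    · rcases hqh with hqb | hqt
      · have h1 : E.δ * ((q 1 : ℝ) - 1) < E.δ * p 1 := by linarith [hpV'.2.1]
        have h2 := lt_of_mul_lt_mul_left h1 hδ.le
        linarith
      · have e1 : E.δ * ((q 1 : ℝ) + 1) = E.δ * q 1 + E.δ := by ring
        have e2 : E.δ * ((p 1 : ℝ) - 1) = E.δ * p 1 - E.δ := by ring
        linarith
    · have e1 : E.δ * ((p 1 : ℝ) + 1) = E.δ * p 1 + E.δ := by ring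
      linarith [hqV'.2.2]
  by_cases heq : p 1 = q 1
  · have hrowB : ∀ k : ℤ, (![k, p 1] : Site 2) ∈ meshVertices E.Ω E.δ → (![k, p 1] : Site 2) ∈ E.zdBoundary :=
      fun k hk => mem_zdBoundary_of_side hE hEΩ hk (Or.inl (by simpa using hph))
    have hpV := meshDomain_subset_meshVertices _ _ (E.zdBoundary_subset_meshDomain hp)
    have hqV := meshDomain_subset_meshVertices _ _ (E.zdBoundary_subset_meshDomain hq)
    have e_p : (![p 0, p 1] : Site 2) = p := by ext k; fin_cases k <;> rfl
    have e_q : (![q 0, p 1] : Site 2) = q := by rw [heq]; ext k; fin_cases k <;> rfl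
    have hpV₀ : (![p 0, p 1] : Site 2) ∈ meshVertices E.Ω E.δ := by rw [e_p]; exact hpV
    have hqV₀ : (![q 0, p 1] : Site 2) ∈ meshVertices E.Ω E.δ := by rw [e_q]; exact hqV
    have hbq2 : |E.δ * p 1 - z.im| ≤ T := hbp.2
    rcases le_total (p 0) (q 0) with h | h
    · have := row_same_arc hE hEΩ hT hnoAB hbp.2 hrowB h hpV₀ hqV₀ hbp.1 hbq.1
      rwa [e_p, e_q] at this
    · have := row_same_arc hE hEΩ hT hnoAB hbp.2 hrowB h hqV₀ hpV₀ hbq.1 hbp.1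
      rw [e_p, e_q] at this
      exact this.symm
  · exfalso
    rcases lt_or_gt_of_ne heq with h | h
    · exact key hp hq hph hqh hbp.2 hbq.2 h
    · exact key hq hp hqh hph hbq.2 hbp.2 h

/-- **Two boundary sites on vertical sides.** In the box (with `2T + 2δ <` the width) they lie on
the same column, where the colour propagates. -/
theorem vsides_same_arc (hE : E.IsZdAdmissible) (hEΩ : E.Ω = Set.Ioo x₀ x₁ ×ℂ Set.Ioo y₀ y₁) (hT : 0 < T)
    (hnoAB : ∀ e₀ ∈ E.zdABEdges, 2 * T ≤ dist (medialPoint E.δ e₀) z) (hTx : 2 * T + 2 * E.δ < x₁ - x₀)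
    {p q : Site 2} (hp : p ∈ E.zdBoundary) (hq : q ∈ E.zdBoundary)
    (hpv : E.δ * (p 0 - 1) ≤ x₀ ∨ x₁ ≤ E.δ * (p 0 + 1)) (hqv : E.δ * (q 0 - 1) ≤ x₀ ∨ x₁ ≤ E.δ * (q 0 + 1))
    (hbp : |E.δ * p 0 - z.re| ≤ T ∧ |E.δ * p 1 - z.im| ≤ T)
    (hbq : |E.δ * q 0 - z.re| ≤ T ∧ |E.δ * q 1 - z.im| ≤ T) :
    (p ∈ E.zdArcA ↔ q ∈ E.zdArcA) := by
  have hδ := hE.delta_pos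
  have key : ∀ {p q : Site 2}, p ∈ E.zdBoundary → q ∈ E.zdBoundary →
      (E.δ * (p 0 - 1) ≤ x₀ ∨ x₁ ≤ E.δ * (p 0 + 1)) → (E.δ * (q 0 - 1) ≤ x₀ ∨ x₁ ≤ E.δ * (q 0 + 1)) →
      |E.δ * p 0 - z.re| ≤ T → |E.δ * q 0 - z.re| ≤ T → p 0 < q 0 → False := by
    intro p q hp hq hpv hqv hbp hbq hlt
    have hpV' := (mem_meshVertices_rect' hEΩ).1
      (meshDomain_subset_meshVertices _ _ (E.zdBoundary_subset_meshDomain hp))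
    have hqV' := (mem_meshVertices_rect' hEΩ).1
      (meshDomain_subset_meshVertices _ _ (E.zdBoundary_subset_meshDomain hq))
    have hle : (p 0 : ℝ) + 1 ≤ q 0 := by exact_mod_cast hlt
    have hle' : E.δ * ((p 0 : ℝ) + 1) ≤ E.δ * q 0 := mul_le_mul_of_nonneg_left hle hδ.le
    have hp1 := abs_le.1 hbp
    have hq1 := abs_le.1 hbq
    rcases hpv with hpl | hpr
    · rcases hqv with hql | hqr
      · have h1 : E.δ * ((q 0 : ℝ) - 1) < E.δ * p 0 := by linarith [hpV'.1.1]
        have h2 := lt_of_mul_lt_mul_left h1 hδ.le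
        linarith
      · have e1 : E.δ * ((q 0 : ℝ) + 1) = E.δ * q 0 + E.δ := by ring
        have e2 : E.δ * ((p 0 : ℝ) - 1) = E.δ * p 0 - E.δ := by ring
        linarith
    · have e1 : E.δ * ((p 0 : ℝ) + 1) = E.δ * p 0 + E.δ := by ring
      linarith [hqV'.1.2]
  by_cases heq : p 0 = q 0
  · have hcolB : ∀ k : ℤ, (![p 0, k] : Site 2) ∈ meshVertices E.Ω E.δ → (![p 0, k] : Site 2) ∈ E.zdBoundary :=
      fun k hk => mem_zdBoundary_of_side hE hEΩ hk (Or.inr (by simpa using hpv))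
    have hpV := meshDomain_subset_meshVertices _ _ (E.zdBoundary_subset_meshDomain hp)
    have hqV := meshDomain_subset_meshVertices _ _ (E.zdBoundary_subset_meshDomain hq)
    have e_p : (![p 0, p 1] : Site 2) = p := by ext k; fin_cases k <;> rfl
    have e_q : (![p 0, q 1] : Site 2) = q := by rw [heq]; ext k; fin_cases k <;> rfl
    have hpV₀ : (![p 0, p 1] : Site 2) ∈ meshVertices E.Ω E.δ := by rw [e_p]; exact hpV
    have hqV₀ : (![p 0, q 1] : Site 2) ∈ meshVertices E.Ω E.δ := by rw [e_q]; exact hqV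
    rcases le_total (p 1) (q 1) with h | h
    · have := col_same_arc hE hEΩ hT hnoAB hbp.1 hcolB h hpV₀ hqV₀ hbp.2 hbq.2
      rwa [e_p, e_q] at this
    · have := col_same_arc hE hEΩ hT hnoAB hbp.1 hcolB h hqV₀ hpV₀ hbq.2 hbp.2
      rw [e_p, e_q] at this
      exact this.symm
  · exfalso
    rcases lt_or_gt_of_ne heq with h | h
    · exact key hp hq hpv hqv hbp.1 hbq.1 h
    · exact key hq hp hqv hpv hbq.1 hbp.1 h

/-- **All boundary sites in the box have the same colour** (the four combinations of sides). -/
theorem same_arc (hE : E.IsZdAdmissible) (hEΩ : E.Ω = Set.Ioo x₀ x₁ ×ℂ Set.Ioo y₀ y₁) (hT : 0 < T)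
    (hnoAB : ∀ e₀ ∈ E.zdABEdges, 2 * T ≤ dist (medialPoint E.δ e₀) z) (hTx : 2 * T + 2 * E.δ < x₁ - x₀)
    (hTy : 2 * T + 2 * E.δ < y₁ - y₀) {p q : Site 2} (hp : p ∈ E.zdBoundary) (hq : q ∈ E.zdBoundary)
    (hbp : |E.δ * p 0 - z.re| ≤ T ∧ |E.δ * p 1 - z.im| ≤ T)
    (hbq : |E.δ * q 0 - z.re| ≤ T ∧ |E.δ * q 1 - z.im| ≤ T) :
    (p ∈ E.zdArcA ↔ q ∈ E.zdArcA) := by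
  rcases side_of_mem_zdBoundary hE hEΩ hp with hph | hpv <;>
    rcases side_of_mem_zdBoundary hE hEΩ hq with hqh | hqv
  · exact hsides_same_arc hE hEΩ hT hnoAB hTy hp hq hph hqh hbp hbq
  · exact corner_same_arc hE hEΩ hT hnoAB hp hq hph hqv hbp hbq
  · exact (corner_same_arc hE hEΩ hT hnoAB hq hp hqh hpv hbq hbp).symm
  · exact vsides_same_arc hE hEΩ hT hnoAB hTx hp hq hpv hqv hbp hbq

end Chains

/-! ## The registered statement -/

/-- **The discrete boundary of a rectangle is monochromatic away from the marked edges**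
(registered sub-goal `ufrs_rect_boundaryMonochromatic` of stmt-CriticalPhenomena-11387, the
geometric input of the one-strand decay ONE). For `ℤ²`-admissible data `E` of the open rectangle
`(x₀, x₁) × (y₀, y₁)`, a centre `z`, a radius `T` with `E.δ ≤ T` and `8T ≤ min (x₁ - x₀) (y₁ - y₀)`,
and all marked midpoints at distance `≥ 2T` from `z`: either no site of the wired arc `E.zdArcA`
or no site of the free arc `E.zdArcB` has its mesh point within distance `T` of `z`. -/
theorem ufrs_rect_boundaryMonochromatic : ∀ (E : DiscreteDobrushin) (x₀ x₁ y₀ y₁ : ℝ), x₀ < x₁ → y₀ < y₁ → E.Ω = Set.Ioo x₀ x₁ ×ℂ Set.Ioo y₀ y₁ → E.IsZdAdmissible → ∀ (z : ℂ) (T : ℝ), E.δ ≤ T → 8 * T ≤ min (x₁ - x₀) (y₁ - y₀) → (∀ e₀ ∈ E.zdABEdges, 2 * T ≤ dist (medialPoint E.δ e₀) z) → (∀ x ∈ E.zdArcA, T < dist (meshPoint E.δ x) z) ∨ (∀ x ∈ E.zdArcB, T < dist (meshPoint E.δ x) z) := by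
  intro E x₀ x₁ y₀ y₁ hx hy hEΩ hE z T hδT h8T hnoAB
  have hδ := hE.delta_pos
  have hT : 0 < T := lt_of_lt_of_le hδ hδT
  have hTx : 2 * T + 2 * E.δ < x₁ - x₀ := by linarith [min_le_left (x₁ - x₀) (y₁ - y₀)]
  have hTy : 2 * T + 2 * E.δ < y₁ - y₀ := by linarith [min_le_right (x₁ - x₀) (y₁ - y₀)]
  by_contra h
  obtain ⟨hA, hB⟩ := not_or.1 h
  push Not at hA hB
  obtain ⟨a, haA, ha⟩ := hA
  obtain ⟨b, hbB, hb⟩ := hB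
  have box : ∀ x : Site 2, dist (meshPoint E.δ x) z ≤ T →
      |E.δ * x 0 - z.re| ≤ T ∧ |E.δ * x 1 - z.im| ≤ T := by
    intro x hxz
    rw [Complex.dist_eq] at hxz
    constructor
    · have h1 := Complex.abs_re_le_norm (meshPoint E.δ x - z)
      rw [Complex.sub_re, meshPoint_re] at h1
      exact h1.trans hxz
    · have h1 := Complex.abs_im_le_norm (meshPoint E.δ x - z)
      rw [Complex.sub_im, meshPoint_im] at h1
      exact h1.trans hxz
  have haZ := E.zdArcA_subset_zdBoundary haA
  have hbZ := E.zdArcB_subset_zdBoundary hbB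
  have hiff := same_arc hE hEΩ hT hnoAB hTx hTy haZ hbZ (box a ha) (box b hb)
  exact Set.disjoint_left.1 hE.disjoint (hiff.1 haA) hbB

end

end Summit.CriticalPhenomena.CardyFormulaZ2.Cruxes.EdgePrecompact.QkzStripBoundaryArm
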